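import Literature.Probability.Percolation.AdjArmsTrim
import Literature.Probability.Percolation.AdjLaneCut
import Literature.Probability.Percolation.ArmEventsProofs
import HarnessLib

/-!
# The order certificate of the adjacent landing: from the routes to the tip keys

Topic `Literature/Probability/Percolation`; family `crit-perc` / near-critical percolation on `𝕋`.
A brick of the near-critical arm-separation theorem for four arms in the ADJACENT colour
arrangement (P. Nolin, EJP 13 (2008), Thm. 11, `j = 4`, `σ = BBWW` [arXiv 0711.4948: Thm. 10],
§4.1 and §4.4: the arms in counterclockwise order, and their extensions): the four actual routes of
the surgery (from the arm starts on `∂Λ_n` to the fences beyond `∂Λ_{2M}`, pairwise disjoint, meeting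
`∂Λ_n` only at their starts, tight outside `Λ_{2M}`) carry the order certificate from the inner circle
(`¬ HexSep` of the closed starts against the open starts, `exists_clean_arms`) to the TIP KEYS
`rotKey M (i a) (t a)` of the four exits (`not_hexSep_keys`): cut the routes at their first visit of
`∂Λ_{2M+1}` (clean crossings, `hexSep_iff_of_four_paths`); the cut points sit within `3k` of the tips
in the frames (tightness), and the row gaps between exits on a common side (`17k` for one colour,
`8k` across colours, both directions) make the perimeter positions of the cut points order-isomorphic
to the keys (`hexSep_congr`).

Everything here is proved; no named facts are introduced.

## References

* P. Nolin, Near-critical percolation in two dimensions, *Electron. J. Probab.* 13 (2008), §4.1,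
  §4.4 (arXiv 0711.4948: §4.1; proof of Thm. 10) [Nolin2008].
* B. Bollobás, O. Riordan, Percolation, CUP 2006, Ch. 7 Lemma 5 p. 169 [BollobasRiordan2006].
-/

noncomputable section

open Set

namespace Literature.Probability.Percolation

open LatticeModels Lanes

/-- A site beyond `∂Λ_{2M}` of norm `2M + 1` in the frame, with a middle row, is the point
`(2M+1, row)` of the side. [folklore] -/
theorem eq_side_pt_of_norm {M : ℕ} {u : Site 2} (hn : triNorm u = 2 * (M : ℤ) + 1) (h0 : 2 * (M : ℤ) < u 0) :
    u = ![2 * (M : ℤ) + 1, u 1] := by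
  have hle := triNorm_le_iff_lin.1 hn.le
  have h0' : u 0 = 2 * M + 1 := by omega
  exact LatticeModels.Mesh.site2_ext' (by rw [h0']; rfl) rfl

/-- **The order certificate on the tip keys.** Four exits `a = 0, 1` (open) and `a = 2, 3` (closed):
sides `i a < 6`, kinds `up a`, actual tip rows `t a` (`8 k a`-middle), scales `1 ≤ k a`, nominal rows
`ζ a = t a - 3 k a` (from above) or `t a`; four pairwise-disjoint actual route sets `R a` of sites of
norm `≥ n` carrying a path from `x a ∈ ∂Λ_n` (met only there) to a site beyond `∂Λ_{2M}`, whose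
sites beyond `∂Λ_{2M}` read in the frame `ρ^{i a}` lie beyond the side in the rows `(ζ a, ζ a + 3 k a)`;
the gap clauses of `OutMidExits4` on a common side; and the inner certificate
`¬ HexSep (x 2) (x 3) (x 0) (x 1)` on `∂Λ_n`. Then `¬ HexSep (κ 2) (κ 3) (κ 0) (κ 1)` for the keys
`κ a = rotKey M (i a) (t a)`. [cite: Nolin2008, §4.1, §4.4 (arXiv 0711.4948: §4.1; proof of Thm. 10)] [cite: BollobasRiordan2006, Ch. 7 Lemma 5 p. 169] -/
theorem not_hexSep_keys {n M : ℕ} (hn : 1 ≤ n) (hnM : n + 1 ≤ 2 * M) {col : Fin 4 → Bool} (hcol : col = ![true, true, false, false])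
    {i : Fin 4 → ℕ} {up : Fin 4 → Bool} {t : Fin 4 → ℤ} {k : Fin 4 → ℕ} {x m : Fin 4 → Site 2} {R : Fin 4 → Set (Site 2)}
    (hi : ∀ a, i a < 6) (hk : ∀ a, 1 ≤ k a) (hmid : ∀ a, -(2 * (M : ℤ)) + 8 * k a < t a ∧ t a + 8 * k a < 0)
    (hx : ∀ a, triNorm (x a) = n) (hm : ∀ a, 2 * (M : ℤ) < triNorm (m a)) (hP : ∀ a, PathIn triGraph (R a) (x a) (m a))
    (hRn : ∀ a, ∀ v ∈ R a, (n : ℤ) ≤ triNorm v) (hin : ∀ a, ∀ v ∈ R a, triNorm v = n → v = x a)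
    (htight : ∀ a, ∀ v ∈ R a, 2 * (M : ℤ) < triNorm v → ∃ u, triRotIsoPow (i a) u = v ∧ 2 * (M : ℤ) < u 0 ∧
      (if up a then t a - 3 * (k a : ℤ) else t a) < u 1 ∧ u 1 < (if up a then t a - 3 * (k a : ℤ) else t a) + 3 * k a)
    (hdisj : Pairwise fun a b => Disjoint (R a) (R b))
    (htne : ∀ a b, a ≠ b → i a = i b → t a ≠ t b)
    (hsame : ∀ a b, a ≠ b → col a = col b → i a = i b → up a = false ∧ (t a < t b → t a + 17 * k a < t b))
    (hdiff : ∀ a b, col a ≠ col b → i a = i b → ((up a = false ∧ t a < t b) ∨ (up a = true ∧ t b < t a)) →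
      t a + 8 * k a < t b ∨ t b + 8 * k a < t a)
    (hsep : ¬ HexSep (hexPos n (x 2)) (hexPos n (x 3)) (hexPos n (x 0)) (hexPos n (x 1))) :
    ¬ HexSep (rotKey M (i 2) (t 2)) (rotKey M (i 3) (t 3)) (rotKey M (i 0) (t 0)) (rotKey M (i 1) (t 1)) := by
  have hM : 1 ≤ M := by omega
  -- ### the first visit of `∂Λ_{2M+1}`
  have cut : ∀ a, ∃ (b : Site 2) (Q : Set (Site 2)) (row : ℤ), Q ⊆ R a ∧ PathIn triGraph Q (x a) b ∧ triNorm b = (2 * M + 1 : ℕ) ∧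
      (∀ v ∈ Q, triNorm v = (2 * M + 1 : ℕ) → v = b) ∧ (∀ v ∈ Q, triNorm v ≤ (2 * M + 1 : ℕ)) ∧
      b = triRotIsoPow (i a) ![2 * (M : ℤ) + 1, row] ∧
      (if up a then t a - 3 * (k a : ℤ) else t a) < row ∧ row < (if up a then t a - 3 * (k a : ℤ) else t a) + 3 * k a := fun a => by
    obtain ⟨a', b, ha', hb, hbR, hab, hQ⟩ := (hP a).exit (R := {v | triNorm v < 2 * M + 1}) (show triNorm (x a) < 2 * M + 1 by rw [hx a]; omega)
      (show ¬ triNorm (m a) < 2 * M + 1 by have := hm a; omega)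
    have hbn : triNorm b = 2 * M + 1 := by
      have h1 := triNorm_le_triNorm_add_one_of_adj hab
      have h2 : triNorm a' < 2 * M + 1 := ha'
      have h3 : ¬ triNorm b < 2 * M + 1 := hb
      omega
    obtain ⟨u, hub, hu0, hu1, hu2⟩ := htight a b hbR (by rw [hbn]; omega)
    have hun : triNorm u = 2 * (M : ℤ) + 1 := by rw [← hbn, ← hub, triNorm_rot]
    refine ⟨b, insert b ({v | triNorm v < 2 * M + 1} ∩ R a), u 1, Set.insert_subset hbR Set.inter_subset_right,
      (hQ.mono (Set.subset_insert _ _)).tail hab (Set.mem_insert _ _), by push_cast; exact hbn, ?_, ?_, ?_, hu1, hu2⟩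
    · rintro v (rfl | ⟨hv, -⟩) hvn
      · rfl
      · push_cast at hvn; exact absurd hvn (ne_of_lt hv)
    · rintro v (rfl | ⟨hv, -⟩)
      · push_cast; exact hbn.le
      · push_cast; exact le_of_lt hv
    · rw [← hub, ← eq_side_pt_of_norm hun hu0]
  choose b Q row hQR hPQ hbN houtQ hQle hbrow hrow1 hrow2 using cut
  -- ### the pattern of the cut points is the inner pattern (reindexed `0, 2, 1, 3`)
  let π : Fin 4 → Fin 4 := ![0, 2, 1, 3]
  have key := hexSep_iff_of_four_paths (n := n) (N := 2 * M + 1) hn (by omega) (x := fun j => x (π j)) (y := fun j => b (π j))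
    (W := fun j => Q (π j))
    (fun j v hv => by rw [mem_triAnn]; exact ⟨hRn _ v (hQR _ hv), hQle _ v hv⟩) (fun j => hx _) (fun j => hbN _) (fun j => hPQ _)
    (fun j v hv hvn => hin _ v (hQR _ hv) hvn) (fun j => houtQ _)
    (fun j j' hjj' => Set.disjoint_of_subset (hQR _) (hQR _) (hdisj fun h => hjj' (by
      have : Function.Injective π := by decide
      exact this h)))
  have hsepb : ¬ HexSep (hexPos (2 * M + 1) (b 2)) (hexPos (2 * M + 1) (b 3)) (hexPos (2 * M + 1) (b 0)) (hexPos (2 * M + 1) (b 1)) := by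
    have e : ∀ j, (fun j => b (π j)) j = b (π j) := fun j => rfl
    intro h; apply hsep
    have := key.1 (by simpa [π] using h)
    simpa [π] using this
  -- ### positions of the cut points against the keys
  have hrowr : ∀ a, -(2 * (M : ℤ) + 1) ≤ row a ∧ row a < 0 := fun a => by
    have h1 := hrow1 a; have h2 := hrow2 a; have h3 := hmid a; have h4 := hk a
    constructor <;> split_ifs at h1 h2 <;> omega
  have hposb : ∀ a, hexPos (2 * M + 1) (b a) = (i a : ℤ) * (2 * M + 1) + (row a + (2 * M + 1)) := fun a => by
    rw [hbrow a]
    have h := hexPos_rot_side0 (N := 2 * M + 1) (hi a) (y := row a) (by push_cast; exact (hrowr a).1) (hrowr a).2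
    push_cast at h ⊢; exact h
  have hkey : ∀ a, rotKey M (i a) (t a) = 2 * (M : ℤ) * i a + (t a + 2 * M) := fun a => rfl
  -- the rows of the cut points follow the tips on a common side
  have hcolv : ∀ a : Fin 4, col a = decide ((a : ℕ) < 2) := fun a => by rw [hcol]; fin_cases a <;> rfl
  have rows : ∀ a c, a ≠ c → i a = i c → t a < t c → row a < row c := by
    intro a c hac hiac hlt
    have h1 := hrow1 a; have h2 := hrow2 a; have h1' := hrow1 c; have h2' := hrow2 c
    have hka := hk a; have hkc := hk c
    by_cases hcc : col a = col c
    · obtain ⟨hua, hga⟩ := hsame a c hac hcc hiac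
      obtain ⟨huc, -⟩ := hsame c a (Ne.symm hac) (hcc.symm) hiac.symm
      have hg := hga hlt
      rw [hua] at h1 h2; rw [huc] at h1' h2'
      simp only [Bool.false_eq_true, ↓reduceIte] at h1 h2 h1' h2'
      omega
    · have hda := hdiff a c hcc hiac
      have hdc := hdiff c a (fun h => hcc h.symm) hiac.symm
      cases hua : up a <;> cases huc : up c <;>
        simp only [hua, huc, Bool.false_eq_true, ↓reduceIte] at h1 h2 h1' h2'
      · have h3 := hda (Or.inl ⟨hua, hlt⟩); omega
      · have h3 := hda (Or.inl ⟨hua, hlt⟩); have h4 := hdc (Or.inr ⟨huc, hlt⟩); omega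
      · omega
      · have h4 := hdc (Or.inr ⟨huc, hlt⟩); omega
  -- order correspondence between keys and positions
  have fwd : ∀ a c, a ≠ c → rotKey M (i a) (t a) < rotKey M (i c) (t c) → hexPos (2 * M + 1) (b a) < hexPos (2 * M + 1) (b c) := by
    intro a c hac hlt
    rw [hposb, hposb]; rw [hkey, hkey] at hlt
    have hra := hrowr a; have hrc := hrowr c; have hma := hmid a; have hmc := hmid c
    have hM0 : (0 : ℤ) ≤ M := by positivity
    rcases lt_trichotomy (i a) (i c) with hl | he | hl
    · have : (i a : ℤ) + 1 ≤ i c := by exact_mod_cast hl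
      nlinarith
    · rw [he] at hlt ⊢
      have htt : t a < t c := by linarith
      have := rows a c hac he htt
      linarith
    · have : (i c : ℤ) + 1 ≤ i a := by exact_mod_cast hl
      have hka := hk a; have hkc := hk c
      nlinarith
  have hne : ∀ a c, a ≠ c → rotKey M (i a) (t a) ≠ rotKey M (i c) (t c) := by
    intro a c hac he
    rw [hkey, hkey] at he
    have hma := hmid a; have hmc := hmid c; have hka := hk a; have hkc := hk c
    have hM0 : (0 : ℤ) ≤ M := by positivity
    have hiac : i a = i c := by
      rcases lt_trichotomy (i a) (i c) with hl | hl | hl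
      · have : (i a : ℤ) + 1 ≤ i c := by exact_mod_cast hl
        nlinarith
      · exact hl
      · have : (i c : ℤ) + 1 ≤ i a := by exact_mod_cast hl
        nlinarith
    rw [hiac] at he
    exact htne a c hac hiac (by linarith)
  have iff : ∀ a c, a ≠ c → (rotKey M (i a) (t a) < rotKey M (i c) (t c) ↔ hexPos (2 * M + 1) (b a) < hexPos (2 * M + 1) (b c)) := by
    intro a c hac
    refine ⟨fwd a c hac, fun h => ?_⟩
    rcases lt_trichotomy (rotKey M (i a) (t a)) (rotKey M (i c) (t c)) with hl | he | hl
    · exact hl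
    · exact absurd he (hne a c hac)
    · exact absurd h (not_lt.2 (fwd c a (Ne.symm hac) hl).le)
  rw [hexSep_congr (iff 2 0 (by decide)) (iff 2 1 (by decide)) (iff 3 0 (by decide)) (iff 3 1 (by decide)) (iff 0 2 (by decide))
    (iff 1 2 (by decide)) (iff 0 3 (by decide)) (iff 1 3 (by decide))]
  exact hsepb

end Literature.Probability.Percolation
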